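import Literature.ModelTheory.FiniteModelTheory.LPTemplateTables
import Literature.ModelTheory.FiniteModelTheory.LPTemplateMachine
import Literature.ModelTheory.FiniteModelTheory.CSPMembershipNP
import HarnessLib

/-!
# Lichter–Pago, Theorem 5.9 — proof (discharge of `LichterPago2025_cohomologyFooled`)

Topic `Literature/ModelTheory/FiniteModelTheory`; the discharge of the named fact
`LichterPago2025_cohomologyFooled` (`CohomologicalConsistencyLimits.lean`): the template is Lichter–Pago's
own `OR_⊥(𝔽₂-equations, 𝔽₃-equations)` in table format (`LPTemplateTables.lpTemplate`); the fooling
instances of the printed proof (complete bipartite link graph) are rejected by Ó Conghaile's algorithm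
(`OrConstructionObstruction.lean`), so they are replaced by SPARSE OR-instances (`SparseOrInstance.lean`,
`SparseOrData.lean`); NP-completeness of the template is `CSPMembershipNP.lean` (membership) and
`LPTemplateMachine.lean` (`3SAT ≤ₚ CSP(lpTemplate)`).

The fooling half — `LPTables.exists_fooling` (unsatisfiable sparse OR-instances with `N ∈ [384t, 480t]`
elements accepted at every level `k` with `4 · 115202 · k ≤ 192t/1728⁴`) and
`LPTables.lp_not_cohomologySolves` (**for every sublinear `k` the algorithm does not solve
`CSP(lpTemplate)`**) — is in `LPTemplateTables.lean`; here:

* `isNPComplete_cspLanguage_lpTemplate` — `CSP(lpTemplate)` is NP-complete;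
* **`LichterPago2025_cohomologyFooled_holds`** — the discharge.

## References

* [LichterPago2025] M. Lichter, B. Pago, arXiv:2407.09097, Thm 5.9 (statement; the instances of the
  printed proof are replaced by the sparse ones, see `OrConstructionObstruction.lean`).
-/

namespace Literature.ModelTheory.FiniteModelTheory

open FirstOrder FirstOrder.Language FirstOrder.Language.Structure
open _root_.Filter
open scoped _root_.Topology
open Literature.Computability.Cryptography (relLanguage RelTables structureOfTables)
open Literature.Computability.Complexity (IsNPComplete IsComplete.of_reducible_holds isNPComplete_kSAT_three_holds kSAT)

namespace LPTables

/-! ### NP-completeness and the discharge -/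

/-- **The template is NP-complete**: `CSP(lpTemplate) ∈ NP` (`cspLanguage_mem_NP`) and `3SAT ≤ₚ
CSP(lpTemplate)` (`LPMachine.kSAT_three_karpReducible_cspLanguage`), completeness propagating from
`3SAT` (`isNPComplete_kSAT_three_holds`). [cite: LichterPago2025, Lemma 3.19 and Thm 5.9] -/
theorem isNPComplete_cspLanguage_lpTemplate : IsNPComplete (cspLanguage lpTemplate) :=
  IsComplete.of_reducible_holds isNPComplete_kSAT_three_holds LPMachine.kSAT_three_karpReducible_cspLanguage
    (cspLanguage_mem_NP lpTemplate ⟨3, by simp [lpVocab], by norm_num⟩)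

end LPTables

/-- **Discharge of `LichterPago2025_cohomologyFooled`** (Lichter–Pago 2025, Theorem 5.9): the
NP-complete template `lpTemplate = OR_⊥(𝔽₂-equations, 𝔽₃-equations)` over the vocabulary
`[3,3,3,3,3,2]` is not solved by the cohomological `k`-consistency algorithm for any sublinear `k`.
The proof differs from the printed one in the fooling instances (sparse OR-instances instead of the
OR-construction on complete bipartite link graphs, which the algorithm of Ó Conghaile's Definition 5
rejects — `LichterPago.orInstance_rejected`). [cite: LichterPago2025, Thm 5.9] -/
theorem LichterPago2025_cohomologyFooled_holds : LichterPago2025_cohomologyFooled :=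
  ⟨LPTables.lpVocab, 7, LPTables.lpTemplate, LPTables.isNPComplete_cspLanguage_lpTemplate,
    fun k hk => LPTables.lp_not_cohomologySolves k hk⟩

end Literature.ModelTheory.FiniteModelTheory
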